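import Mathlib
import HarnessLib
import HarnessLib.Audit
import Summits.Schanuel.Statement
import HarnessLib.Audit.Status.Attr

/-!
Route: RecursiveCore

DORMANT since 2026-08-24T08:55:12Z (reconciler: no traction for 6.6 d (last activity item-evidence-added at 2026-08-17T16:54:06Z); parked, not closed — `ledger route dormant route-Schanuel-RecursiveCore --off` to reactivate) — unstaffed, not closed; items shared with open routes are served there. `ledger route dormant <id> --off` reactivates.

# Route RecursiveCore — Schanuel splits at the recursive core 𝓡 (exp returns to the algebraic
closure of the coordinates: logs, Fix(exp), exp-Gauss cycles): 𝓡 free + Schanuel relative to 𝓡,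
anti-Lagrange as linear shadow

It suffices to show X = RecursiveSchanuel ∧ OffRecursiveSchanuel. Call a tuple z ∈ ℂⁿ RECURSIVE when
every e^{z_i} is algebraic
over ℚ(z₁,…,zₙ) — the exponential sends the tuple back into the algebraic closure of its own
coordinates (logarithms of algebraic
numbers; fixed points and integer-shifted cycles of exp; periodic orbits of the continued-logarithm
map T y = {eʸ} and, in
log-coordinates, of the continued-exponential map S y = {−log y}; solutions of square triangular
systems P_i(z, e^{z_i}) = 0) — and let
the RECURSIVE CORE 𝓡 be the ℚ-subspace of ℂ swept by the spans of recursive tuples (𝓛 = exp⁻¹(ℚ̄) ⊊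
𝓡). RecursiveSchanuel: a
ℚ-linearly independent recursive tuple is algebraically independent. OffRecursiveSchanuel: adjoining
(x, eˣ), x ℚ-independent modulo
𝓡, to a recursive field ℚ(v, e^v) raises the transcendence degree by the full |x|. The split is
exact (Schanuel ⟺ X, both directions
bookkeeping: supports Assembly and SplitOfSchanuel). Realises card exp-gauss-map-anti-lagrange (with
merged critical-base-e-kneading):
its anti-Lagrange statement — no nonzero real algebraic number has an eventually periodic T- or
S-expansion — is the period-graded,
real, integer-shifted face of the linear shadow RecursiveHermiteLindemann of RecursiveSchanuel.
Lean: `(∀ (n : ℕ) (z : Fin n → ℂ), LinearIndependent ℚ z → (∀ i, IsAlgebraic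
(IntermediateField.adjoin ℚ (Set.range z)) (Complex.exp (z i))) → AlgebraicIndependent ℚ z) ∧ (∀ (k
m : ℕ) (v : Fin k → ℂ) (x : Fin m → ℂ), (∀ i, IsAlgebraic (IntermediateField.adjoin ℚ (Set.range v))
(Complex.exp (v i))) → LinearIndependent ℚ ((Submodule.span ℚ {w : ℂ | ∃ (j : ℕ) (u : Fin j → ℂ), (∀
i, IsAlgebraic (IntermediateField.adjoin ℚ (Set.range u)) (Complex.exp (u i))) ∧ w ∈ Submodule.span
ℚ (Set.range u)}).mkQ ∘ x) → Algebra.trdeg ℚ (IntermediateField.adjoin ℚ (Set.range v ∪ Set.range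
(Complex.exp ∘ v))) + (m : Cardinal) ≤ Algebra.trdeg ℚ (IntermediateField.adjoin ℚ (Set.range v ∪
Set.range (Complex.exp ∘ v) ∪ (Set.range x ∪ Set.range (Complex.exp ∘ x)))))`

## Assembly
Bookkeeping over Mathlib (tower law `IntermediateField.trdeg_add_eq`, monotonicity, finite
generation), staffable now; the deciding
theorem is `closes (hR : RecursiveSchanuel) (hO : OffRecursiveSchanuel) (hA : Assembly) : Schanuel
:= hA hR hO`. Content of Assembly:
given z ∈ ℂⁿ ℚ-linearly independent, let W = span_ℚ z ∩ 𝓡 (𝓡 is a ℚ-subspace: concatenating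
recursive tuples is recursive), pick a basis
w of W (k vectors) and z′ (n − k vectors of span z) independent modulo 𝓡; each w_i lies in the span
of a recursive tuple, and the
concatenation v of these tuples is recursive with w ⊂ span v. OffRecursiveSchanuel(v, z′): trdeg
ℚ(v, e^v, z′, e^{z′}) ≥ trdeg ℚ(v) +
n − k (e^v is algebraic over ℚ(v)). RecursiveSchanuel applied to a basis of span v chosen among its
coordinates (still recursive) makes
that basis, hence the k independent vectors w of its span, algebraically independent: trdeg ℚ(w) =
k. Now compare inside the compositum
C = ℚ(v, e^v, z, e^z): trdeg C ≤ trdeg ℚ(z, e^z) + trdeg_{ℚ(z,e^z)}(v) ≤ trdeg ℚ(z, e^z) + trdeg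
ℚ(v) − k (w ⊂ span z and w ⊂ ℚ(v); z′,
e^{z′}, e^v are algebraic over ℚ(z, e^z, v)), while trdeg C ≥ trdeg ℚ(v) + n − k; all degrees are
finite, so trdeg ℚ(z, e^z) ≥ n.
The converse SplitOfSchanuel is a support, so X ⟺ Schanuel.

Rationale: WHY THIS LINE. Mechanism (card exp-gauss-map-anti-lagrange): the numerations DEFINED BY exp (Rényi
f-expansions with f = log, f = e^{−t}, Renyi1957;
the only dynamics paper, Neunhauserer2018, treats integer bases metrically) have periodic points =
integer-shifted exponential cycles,
and Schanuel reads there as the inversion of Lagrange's theorem ("algebraic ⟹ aperiodic"); closing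
that instance family under its
natural operations (ℚ-span, concatenation, algebraic instead of affine recursion) gives an intrinsic
object, the recursive core 𝓡,
whose one-dimensional layer is the solution set of all one-variable equations p(z, e^z) = 0 (the
object of Marker2006 and
MantovaZannier2016 Prop. 2.2, where SC ⟹ such solutions are generic) and which contains the whole
log sector 𝓛 (LogPatterns'
LogSector = the case P_i = Y − α_i, support LogSectorInside) but is strictly larger (fixed points of
exp, T-cycles: support
CoreBeyondLogs, unconditional). Splitting Schanuel at 𝓡 is exact by the same tower-law bookkeeping
as the 𝓛-split (LogPatterns) and
the ecl(∅)-split (Kirby2010EAEF, tree fact `schanuelConjecture_iff_ecl_empty`), and it is the split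
the model theory points at: in
the Bays–Kirby fields 𝔹_P (BaysKirby2018ANT §9.2, barrier AxiomsDoNotForceSchanuel) the Schanuel
property fails exactly on a
recursive pair (e^τ = 1, P(e, τ) = 0) and holds relative to it — RecursiveSchanuel is the half no
axiomatics can give,
OffRecursiveSchanuel the half bounded from outside by Ax/Kirby relative Schanuel (Ax1971,
Kirby2010EAEF Thm 1.2). Imported areas:
f-expansions / symbolic dynamics (periodic orbit ↔ recursive tuple, period ↔ Khovanskii depth,
certified pattern search as a refutation
channel) and exponential algebra (predimension, ecl); no analytic engine is claimed beyond
Hermite–Lindemann — the route's job is to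
decide the summit through a new sector boundary, name the linear shadow (RecursiveHermiteLindemann,
n = 1 = HL, pure-log case = Baker's
ℚ-corollary, first open rung e^e) and keep the card's period ladder (SecondOrderHL = pattern length
2, ENotLogParry = the orbit of e)
attached to it; no prior route or negative (index empty) has a self-referential sector or a
real-dynamics object.

RANKED CRUXES. #2 RecursiveSchanuel (crux) — SCHANUEL ON THE RECURSIVE CORE: if z₁,…,zₙ ∈ ℂ are
ℚ-linearly independent and every e^{z_i} is algebraic over ℚ(z₁,…,zₙ) (recursive tuple: logs of
algebraic numbers, fixed points / integer-shifted cycles of exp, T- and S-periodic orbits, solutions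
of triangular systems P_i(z, e^{z_i}) = 0), then z₁,…,zₙ are algebraically independent over ℚ
(equivalently trdeg ℚ(z, e^z) = n, all of it carried by z). n = 1 is Hermite–Lindemann; the diagonal
case P_i = Y − α_i is AlgIndepLogarithms; its linear shadow is RecursiveHermiteLindemann. First
conjunct of X. [difficulty: open-problem] (why it might fail: Contains algebraic independence of
logarithms (π ⊥ log 2) and Re z₀ ⊥ Im z₀ for fixed points z₀ = e^{z₀}: no method yields algebraic
(vs linear) independence; false iff SC fails on a recursive tuple — exactly the locus of the
Bays–Kirby 𝔹_P exceptions.) [Marker2006, MantovaZannier2016, Roy1992, Pila2022, BaysKirby2018ANT,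
Waldschmidt2000]
#3 RecursiveHermiteLindemann (crux) — RECURSIVE HERMITE–LINDEMANN (card C1/S2 in pure form; verbatim
the mooted stmt-Schanuel-7599, whose grounding/refuter notes carry over): if z₁,…,zₙ ∈ ℂ are such
that every e^{z_i} lies in ℚ̄ + ℚz₁ + ⋯ + ℚzₙ (linearly recursive: shifted exp-chains and -cycles,
periodic points of z ↦ e^z + k, Fix(exp) and conjugates, T-orbits, log-coordinates of S-orbits, pure
logarithms), then the only algebraic number in span_ℚ(z) is 0. n = 1 is HL (tree
`transcendental_exp_holds`); the pure-log case is Baker's ℚ-corollary (tree `baker_holds`); implied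
by RecursiveSchanuel (support HLShadowOfRecursive); implies AntiLagrange and SecondOrderHL
(supports). [difficulty: open-problem] (why it might fail: n = 2 already contains e^e ∉ ℚ̄ (z = (1,
e)) and e ∉ ℚ̄ + ℚπi (z = (πi, πi + 1)); exp∘exp lies in no E- /Gevrey class and no method treats
self-referential tuples; false iff SC fails on a linearly recursive tuple.) [BakerTNT1975,
Chudnovsky1984, DaquinoFornasieroTerzo2017, Marker2006, Kirby2010EAEF]
#4 OffRecursiveSchanuel (crux) — SCHANUEL RELATIVE TO THE RECURSIVE CORE: let 𝓡 = {w ∈ ℂ : w lies in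
the ℚ-span of some recursive tuple} (a ℚ-subspace ⊇ 𝓛); for every recursive tuple v (any length,
repeats allowed) and every x₁,…,x_m ℚ-linearly independent modulo 𝓡, trdeg_ℚ ℚ(v, e^v, x, eˣ) ≥
trdeg_ℚ ℚ(v, e^v) + m. Second conjunct of X. Instances: v = (iπ), x = (1) is e ⊥ π; v = (), x = (1,
e) is e ⊥ e^e (granted 1, e independent modulo 𝓡, which SC predicts); by Kirby2010EAEF Prop. 7.2
only x inside ecl(∅) can matter. [difficulty: open-problem] (why it might fail: Contains e ⊥ π and
the freeness of the tower 1, e, e^e, … — summit strength off the core, with no engine here; false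
iff an essential counterexample to SC (Kirby: inside ecl ∅) has a coordinate outside 𝓡.)
[Kirby2010EAEF, BaysKirby2018ANT, Ax1971, Waldschmidt2000, Lang1966]
#5 AntiLagrange (crux) — ANTI-LAGRANGE FOR THE EXPONENTIAL GAUSS MAPS (the card's statement, all
patterns; verbatim the mooted stmt-Schanuel-7598): (T) for every real algebraic x ≠ 0 and all m, p >
0, T^(m+p) x ≠ T^m x where T y = {eʸ} = Int.fract (exp y); (S) for every real algebraic x > 0, x ≠ 1
and all m, p > 0, S^(m+p) x ≠ S^m x where S y = {−log y} (Lean's log 0 = 0 makes terminating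
continued exponentials eventually 0, deliberately included). Pattern m + p = 1 is HL; m + p = 2 is
SecondOrderHL / ExpLogLinearRung; x = 1 of (T) is ENotLogParry. Implied by RecursiveHermiteLindemann
(support AntiLagrangeOfRecursiveHL, already proved as evidence on stmt-Schanuel-7610). [deps:
RecursiveHermiteLindemann] [difficulty: open-problem] (why it might fail: False only with SC: iff
some real algebraic x ≠ 0 has an eventually periodic continued-logarithm/ -exponential expansion — a
sparse depth-(m+p) tower identity in a shape no PSLQ search probes; certified ball-arithmetic search
(kit j000302) pending.) [Renyi1957, Neunhauserer2018, SchmidtPisot1980, Waldschmidt2000]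
#9 SplitOfSchanuel (support) — EXACTNESS OF THE SPLIT: Schanuel → RecursiveSchanuel ∧
OffRecursiveSchanuel (first: trdeg ℚ(z, e^z) = trdeg ℚ(z) ≥ n forces algebraic independence, tree
lemmas `algebraicIndependent_of_le_trdeg_adjoin`, `trdeg_adjoin_union_eq_of_isAlgebraic` generalised
to T algebraic over K(S); second: take a basis B ⊆ coordinates of span v, B ++ x is ℚ-free because x
is free mod 𝓡 ⊇ span v, Schanuel gives |B| + m ≤ trdeg, and trdeg ℚ(v, e^v) = trdeg ℚ(B) ≤ |B|).
Certifies that no item of the route is refutable short of refuting Schanuel. [difficulty: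
provable-now] [Waldschmidt2000, Kirby2010EAEF, Lang1966]
#9 HLShadowOfRecursive (support) — RecursiveSchanuel → RecursiveHermiteLindemann (choose a ℚ-basis B
among the z_i; B is recursive since a_i + Σ c_ij z_j ∈ ℚ̄ + ℚ(B) is algebraic over ℚ(B); B
algebraically independent ⟹ a nonzero ℚ-combination Σ d_i b_i cannot be a root of a nonzero rational
polynomial). [difficulty: provable-now] [Waldschmidt2000, BakerTNT1975]
#9 AntiLagrangeOfRecursiveHL (support) — RecursiveHermiteLindemann → AntiLagrange (the old
ExpGaussMap assembly, PROVED sorry-free as refuter evidence AssemblySch.lean on stmt-Schanuel-7610: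
T-orbits are linearly recursive tuples e^{z_i} = z_{i+1} + ⌊e^{z_i}⌋ containing the algebraic x;
S-orbits in log-coordinates w_i = −(k_i + y_{i+1}) with the case split at the first zero / purely
periodic / minimal preperiod supplying a nonzero algebraic element of the span). [difficulty:
provable-now] [Renyi1957, BakerTNT1975, Kirby2010EAEF]
#9 SecondOrderHL (support) — HERMITE–LINDEMANN ONE STOREY UP (named rung = pattern length 2 of
AntiLagrange; verbatim stmt-Schanuel-7601): for algebraic β ≠ 0 and rational a, b with b ≠ 0, e^(a +
b·e^β) is transcendental (contains e^e, e^{1/e}, e^{e^√2} ∉ ℚ̄; in print only 'e^e or e^{e²}',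
Brownawell–Waldschmidt, BakerTNT1975 Thm 12.2 p. 111). [difficulty: open-problem] [BakerTNT1975,
Chudnovsky1984, Rivoal2024, Waldschmidt2004]
#9 RecursiveGivesSecondOrder (support) — RecursiveHermiteLindemann → SecondOrderHL (n = 2 with z =
(β, a + b e^β); PROVED sorry-free as refuter evidence on stmt-Schanuel-7605, to be re-landed in
Theorems). [difficulty: provable-now] [BakerTNT1975, Hermite1873]
#9 ExpLogLinearRung (support) — the depth-one MIXED LINEAR RUNG over ℚ̄ (verbatim
stmt-Schanuel-7600; shared with cards linear-schanuel-all-depths L1 and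
tensor-mixed-gevrey-division): for algebraic α ≠ 0 and l ≠ 0 with e^l algebraic, c₀ + c₁e^α + c₂l =
0 with algebraic c's forces c₁ = c₂ = 0 (contains 1, e, π ℚ̄-independent via l = iπ; the S-pattern
(1,1) into W(e^{−k})). Implied by RecursiveSchanuel at n = 2. [difficulty: open-problem]
[BakerTNT1975, Rivoal2024, Chudnovsky1984, Waldschmidt2004, FischlerRivoal2024]
#9 ENotLogParry (support) — e IS NOT A LOG-PARRY BASE (flagship single-orbit instance, x = 1 of
AntiLagrange(T); verbatim stmt-Schanuel-7602, whose certified-numerics notes carry over: no pattern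
with m + p ≤ 1500 at 820 digits): the T-orbit of 1 (T 1 = e − 2, T² 1 = e^{e−2} − 2 = 0.0509…) is
not eventually periodic. [difficulty: open-problem] [BakerTNT1975, SchmidtPisot1980,
Neunhauserer2018, AdamczewskiBugeaud2007]
#9 LogSectorInside (support) — THE LOG SECTOR SITS INSIDE THE RECURSIVE SECTOR: RecursiveSchanuel →
AlgIndepLogarithms (a tuple of logarithms of algebraic numbers is recursive: e^{l_i} ∈ ℚ̄ is
algebraic over ℚ(l)); makes the containment LogPatterns.LogSector ⊆ RecursiveSchanuel and the
barrier AlgebraicIndependenceOfLogarithms explicit theorems. [difficulty: provable-now] [Roy1992,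
Pila2022, Waldschmidt2005]
#9 CoreBeyondLogs (support) — THE RECURSIVE CORE IS STRICTLY BIGGER THAN 𝓛 = exp⁻¹(ℚ̄),
unconditionally: some w in the span of a recursive tuple has e^w transcendental (witness: the real
root w ∈ (1/2, 1) of e^w = 3w by the intermediate value theorem; (w) is recursive; w algebraic would
make e^w = 3w both transcendental (HL, tree `transcendental_exp_holds`) and algebraic). [difficulty:
provable-now] [Hermite1873, Lindemann1882, MantovaZannier2016]

TWO-LAYER PLAN. Foreseen glued splits (k ≤ 3, depth 1), filed only when something lands: (i)
RecursiveSchanuel ⇐ DiagonalRecursive (each e^{z_i}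
algebraic over ℚ(z_i) alone: logs, fixed points, one-variable p(z, e^z) = 0 — the Marker/Mantova
layer) → CoupledRecursive (genuinely
triangular/cyclic systems: T-cycles, shifted towers) → RecursiveSchanuel; (ii)
RecursiveHermiteLindemann ⇐ (n ≤ 2, split by the shape
of the coefficient matrix: triangular = towers ∋ e^e, cyclic = 2-cycles of z ↦ e^z + k, conjugate
pairs of Fix(exp)) → (n ≥ 3) →
RecursiveHermiteLindemann; (iii) AntiLagrange ⇐ PatternsUpToTwo (HL + SecondOrderHL +
RecursiveHermiteLindemann at n = 2) →
PatternsBeyondTwo → AntiLagrange; (iv) OffRecursiveSchanuel ⇐ (x inside ecl(∅), via the tree's Kirby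
facts) → (the tower sector over
1) → OffRecursiveSchanuel.

KILL CRITERIA. Any refutation of RecursiveSchanuel, OffRecursiveSchanuel, RecursiveHermiteLindemann,
AntiLagrange, SecondOrderHL, ExpLogLinearRung or
ENotLogParry refutes Schanuel itself (SplitOfSchanuel + the support implications), so it closes
every Schanuel route; this route then
closes `refuted:<Decl>` having served as the refutation channel it advertises (a certified real
algebraic x with an eventually periodic
continued logarithm is the cheapest such witness). A refutation of LogPatterns.LogSector
(AlgIndepLogarithms) refutes RecursiveSchanuel
(LogSectorInside). If the Assembly bookkeeping were found to need more than the two cruxes (it does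
not on paper — see NOTES), pivot by
restating OffRecursiveSchanuel over the field ℚ(𝓡) as LogPatterns does. If RecursiveSchanuel is
shown EQUIVALENT to Schanuel the split is
vacuous ⇒ close `superseded` in favour of LogPatterns/EclCore-type routes; if LogPatterns' assembly
and both its sectors are proved the
summit is closed and this route is moot.

NOT DECOMPOSED YET. The dynamics of the card that does not bear on the summit (T is an AFN map with
a barely-infinite invariant measure, Zweimuller2000 /
Thaler1983; S has a finite Rényi measure; digit laws, itinerary injectivity, zeta function /
log-Parry bases of the merged card) — provable
but not items here (the mooted stmt-Schanuel-7607/7608/7609 keep their notes); the metric /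
shrinking-target statements (card C2) which need
transcendence measures for tower points that do not exist beyond depth 1; the relation 𝓡 ⊆ ecl(∅)
(true for regular solutions of the
triangular systems, and for all of 𝓡 under SC) and the reduction of OffRecursiveSchanuel to x ⊂
ecl(∅) via the tree's Kirby facts
(`kirby_relative_schanuel_complex`); full trdeg statements for linearly recursive tuples (only the
linear shadow is a crux); the certified
pattern search itself (kit evidence, not an item).

CHEAPEST FALSIFIER. (1) The certified pattern search already queued by refuter g41-31 on the mooted
items (kit j000302: ≈1500 explicit real algebraic x of
degree ≤ 4 / small height, T- and S-orbits to 250 steps in ball arithmetic, plus the orbit of 1 to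
20000 steps): one certified coincidence
T^(m+p) x = T^m x kills AntiLagrange, RecursiveHermiteLindemann, RecursiveSchanuel and Schanuel at
once (uncertified runs: 0 hits,
m + p ≤ 1500 for x = 1). (2) Lookup that would downgrade novelty (not truth): a printed 'Schanuel
splits at exp-algebraically
self-sufficient tuples' — searched (Marker2006 / MantovaZannier2016 Prop 2.2 have only the
one-variable layer under SC; Kirby2010EAEF the
ecl(∅)-split; BaysKirby2018ANT the recursive exceptions in 𝔹_P). (3) Sanity instances of
OffRecursiveSchanuel that are theorems: v = (),
x = (1): trdeg ℚ(1, e) ≥ 1 ✓; v = (log 2), x = (√2·log 2) is excluded iff √2 log 2 ∈ 𝓡 — consistent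
either way (Gel'fond–Schneider).

NUMBERS. T 1 = e − 2 = 0.71828…, T² 1 = e^{e−2} − 2 = 0.050906…; itinerary of e:
2,2,1³⁸,2,1²,2,1⁸,2,1³,2,1¹³,… (no pattern with m + p ≤ 1500 at
820 digits, refuter note on stmt-Schanuel-7602); admissible T-cycles of length ≤ 3: (1,2) with y* =
0.68742200969…, (1,1,2) with
0.50115900068…; S-fixed points W(e^{−k}): Ω = 0.567143…, 0.278464…, 0.120028… (transcendental, HL);
CoreBeyondLogs witness: e^w = 3w,
w = 0.619061…; known unconditionally inside the cruxes: n = 1 (HL), pure-log linear shadow (Baker),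
'e^e or e^{e²}' (BakerTNT1975
Thm 12.2 p. 111), strong six exponentials (Roy1992). Items at open: 14 (4 cruxes, 9 supports, 1
assembly).

DEFINITION REQUESTS. None. 𝓡 is inlined as the ℚ-span of {w | ∃ recursive u, w ∈ span u}; T and S
are inline `fun y => Int.fract (Real.exp y)` /
`fun y => Int.fract (-Real.log y)`; Hermite–Lindemann, Baker and AlgIndepLogarithms exist in the
tree. If a grounder prefers a named
notion, `recursiveCore : Submodule ℚ ℂ` under Summits/Schanuel/Schanuel/Theorems (not requested
now).

Novelty: Searches (2026-08-15): `lit search --source arxiv "Schanuel conjecture generic solutions exponential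
algebraic equations"` (3: arXiv:1402.0685
MantovaZannier2016 READ pp. 2–4 — Prop. 2.2: under SC the solutions of p(z, e^z) = 0 algebraic over
a f.g. field lie in a finite-dim
ℚ-space; arXiv:0708.1352 Kirby; arXiv:1907.09858 j-analogue); `lit search --source zbmath "Marker
Zilber's pseudoexponentiation"` (2:
Marker2006 doi:10.2178/jsl/1154698577, Aslanyan–Eterović–Kirby 2023); `lit galaxy search --star all`
for "Schanuel's conjecture generic
solutions" / "polynomial-exponential equations and Zilber" / "strong exponential closedness" (0 rows
each); `lit frontier Schanuel --since
2020` (30 rows: unlikely intersections, zeta values, quasi-elliptic Schanuel — nothing on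
self-referential tuples or numeration); `lit bridges
Schanuel --cross any` (30, none); `lit search --hybrid` DOWN (rc 75) this session; tree reads:
LogPatterns (𝓛-split), EclCore /
`schanuelConjecture_iff_ecl_empty` (ecl-split), Barriers AxiomsDoNotForceSchanuel (𝔹_P),
AlgebraicIndependenceOfLogarithms; inherited
from the card/retired route: zbMATH "continued logarithm" (Neunhauserer2018 only, integer bases,
metric), galaxy "continued logarithm" /
"continued exponential" (noise), BakerTNT1975 p. 111 and Chudnovsky1984 pp. 306–308 READ.
Nearest prior art found: MantovaZannier2016 Prop. 2.2 / Marker2006 (the one-variable layer of 𝓡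
under SC); Kirby2010EAEF = arXiv:0810.4285
(SC ⟺ SC on ecl(∅); relative Schanuel); Bays  [refs: 10.2178/jsl/1154698577, 1402.0685, 0708.1352, 1907.09858, 0810.4285, 1808.01222, doi:10.2178/jsl/1154698577, MantovaZannier2016, Marker2006, Neunhauserer2018, BakerTNT1975, Chudnovsky1984, Renyi1957]

Barriers (technique_class: sector-split recursive-core f-expansions instance-ladder): - technique_class: sector-split recursive-core f-expansions instance-ladder
- Literature.Barriers.Schanuel.AlgebraicIndependenceOfLogarithms: it does not evade it —
RecursiveSchanuel ⊇ AlgIndepLogarithms (support LogSectorInside makes the containment a theorem) and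
no algebraic-independence engine is claimed; the bet is structural: the split puts every
self-referential instance (logs, Fix(exp), exp-Gauss cycles, Bays–Kirby kernel relations) in ONE
named half whose linear shadow RecursiveHermiteLindemann is of Hermite–Lindemann strength (n = 1 HL,
pure-log case Baker — both proved in tree) so that partial results attach rung by rung, and leaves e
⊥ π and the free tower to the other half.
- Literature.Barriers.Schanuel.AxiomsDoNotForceSchanuel: consistent and used as a guide — the 𝔹_P
fields violate the Schanuel property exactly on a recursive tuple ((1, τ) with e^τ = 1, P(e, τ) = 0)
while keeping it relative to that tuple, so RecursiveSchanuel is the half no soft/axiomatic argument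
delivers and the route does not attempt one (its cruxes are arithmetic statements in ℂ);
OffRecursiveSchanuel is bounded from outside by Ax/Kirby relative Schanuel over ecl(∅), which is a
theorem.
- Literature.Barriers.Schanuel.AxSchanuelFunctionalNotNumerical: respected — Ax/Kirby enter only to
locate counterexamples (essential ones lie in ecl(∅); recursive tuples solve square exp-algebraic
systems), never to produce a numerical instance.
- Literature.Barriers.Schanuel.SchanuelPropertyNotFirstOrder

History (route lifecycle, newest last):
- 2026-08-15T18:53:59Z · rev 1: restated LogSectorInside (stmt-Schanuel-12204) — restate LogSectorInside with AlgIndepLogarithms inlined verbatim (= LogPatterns.LogSector) so no undeclared @[conjecture] leaf is reached (deps.unproved undecla (planner-plancard-Schanuel-Schanuel-exp-gauss--8e5a92ae-g2-0)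
- 2026-08-24T08:55:12Z · DORMANT — reconciler: no traction for 6.6 d (last activity item-evidence-added at 2026-08-17T16:54:06Z); parked, not closed — `ledger route dormant route-Schanuel-Recursi (operator:999:1847970)

sub-problem: Schanuel · status: dormant · opened planner-plancard-Schanuel-Schanuel-exp-gauss--8e5a92ae-g2-0 2026-08-15T18:51:00Z · rev 2 · ledger route-Schanuel-RecursiveCore
GENERATED by the gate from the ledger (D-0016/17). Provers cite these decls: `theorem foo : Summit.Schanuel.Schanuel.Theses.RecursiveCore.<Decl> := …` in Summits/Schanuel/Schanuel/Theorems/<Name>.lean.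
-/

namespace Summit.Schanuel.Schanuel.Theses.RecursiveCore

open scoped BigOperators Topology Manifold Classical MeasureTheory ProbabilityTheory Matrix InnerProductSpace ComplexConjugate ContinuousMap
open Filter Set Function TopologicalSpace MeasureTheory

attribute [summit_statement] _root_.Schanuel

open Literature.Periods

/-- item stmt-Schanuel-12193 · crux · rank 2 · open · by planner
why it might fail: Contains algebraic independence of logarithms (π ⊥ log 2) and Re z₀ ⊥ Im z₀ for fixed points z₀ = e^{z₀}: no method yields algebraic (vs linear) independence; false iff SC fails on a recursive tuple — exactly the locus of the Bays–Kirby 𝔹_P exceptions.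
sources: Marker2006, MantovaZannier2016, Roy1992, Pila2022, BaysKirby2018ANT, Waldschmidt2000
[crux] SCHANUEL ON THE RECURSIVE CORE: if z₁,…,zₙ ∈ ℂ are ℚ-linearly independent and every e^{z_i}
is algebraic over ℚ(z₁,…,zₙ) (recursive tuple: logs of algebraic numbers, fixed points /
integer-shifted cycles of exp, T- and S-periodic orbits, solutions of triangular systems P_i(z,
e^{z_i}) = 0), then z₁,…,zₙ are algebraically independent over ℚ (equivalently trdeg ℚ(z, e^z) = n,
all of it carried by z). n = 1 is Hermite–Lindemann; the diagonal case P_i = Y − α_i is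
AlgIndepLogarithms; its linear shadow is RecursiveHermiteLindemann. First conjunct of X.
[difficulty: open-problem] -/
@[route_item "route-Schanuel-RecursiveCore", crux]
def RecursiveSchanuel : Prop :=
  ∀ (n : ℕ) (z : Fin n → ℂ), LinearIndependent ℚ z → (∀ i, IsAlgebraic (IntermediateField.adjoin ℚ (Set.range z)) (Complex.exp (z i))) → AlgebraicIndependent ℚ z

/-- item stmt-Schanuel-12194 · crux · rank 3 · open · by planner
why it might fail: n = 2 already contains e^e ∉ ℚ̄ (z = (1, e)) and e ∉ ℚ̄ + ℚπi (z = (πi, πi + 1)); exp∘exp lies in no E- /Gevrey class and no method treats self-referential tuples; false iff SC fails on a linearly recursive tuple.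
sources: BakerTNT1975, Chudnovsky1984, DaquinoFornasieroTerzo2017, Marker2006, Kirby2010EAEF
[crux] RECURSIVE HERMITE–LINDEMANN (card C1/S2 in pure form; verbatim the mooted stmt-Schanuel-7599,
whose grounding/refuter notes carry over): if z₁,…,zₙ ∈ ℂ are such that every e^{z_i} lies in ℚ̄ +
ℚz₁ + ⋯ + ℚzₙ (linearly recursive: shifted exp-chains and -cycles, periodic points of z ↦ e^z + k,
Fix(exp) and conjugates, T-orbits, log-coordinates of S-orbits, pure logarithms), then the only
algebraic number in span_ℚ(z) is 0. n = 1 is HL (tree `transcendental_exp_holds`); the pure-log case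
is Baker's ℚ-corollary (tree `baker_holds`); implied by RecursiveSchanuel (support
HLShadowOfRecursive); implies AntiLagrange and SecondOrderHL (supports). [difficulty: open-problem] -/
@[route_item "route-Schanuel-RecursiveCore"]
def RecursiveHermiteLindemann : Prop :=
  ∀ (n : ℕ) (z : Fin n → ℂ), (∀ i, ∃ (a : ℂ) (c : Fin n → ℚ), IsAlgebraic ℚ a ∧ Complex.exp (z i) = a + ∑ j, (c j : ℂ) * z j) → ∀ c : Fin n → ℚ, IsAlgebraic ℚ (∑ j, (c j : ℂ) * z j) → ∑ j, (c j : ℂ) * z j = 0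

/-- item stmt-Schanuel-12195 · crux · rank 4 · open · by planner
why it might fail: Contains e ⊥ π and the freeness of the tower 1, e, e^e, … — summit strength off the core, with no engine here; false iff an essential counterexample to SC (Kirby: inside ecl ∅) has a coordinate outside 𝓡.
sources: Kirby2010EAEF, BaysKirby2018ANT, Ax1971, Waldschmidt2000, Lang1966
[crux] SCHANUEL RELATIVE TO THE RECURSIVE CORE: let 𝓡 = {w ∈ ℂ : w lies in the ℚ-span of some
recursive tuple} (a ℚ-subspace ⊇ 𝓛); for every recursive tuple v (any length, repeats allowed) and
every x₁,…,x_m ℚ-linearly independent modulo 𝓡, trdeg_ℚ ℚ(v, e^v, x, eˣ) ≥ trdeg_ℚ ℚ(v, e^v) + m.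
Second conjunct of X. Instances: v = (iπ), x = (1) is e ⊥ π; v = (), x = (1, e) is e ⊥ e^e (granted
1, e independent modulo 𝓡, which SC predicts); by Kirby2010EAEF Prop. 7.2 only x inside ecl(∅) can
matter. [difficulty: open-problem] -/
@[route_item "route-Schanuel-RecursiveCore", crux]
def OffRecursiveSchanuel : Prop :=
  ∀ (k m : ℕ) (v : Fin k → ℂ) (x : Fin m → ℂ), (∀ i, IsAlgebraic (IntermediateField.adjoin ℚ (Set.range v)) (Complex.exp (v i))) → LinearIndependent ℚ ((Submodule.span ℚ {w : ℂ | ∃ (j : ℕ) (u : Fin j → ℂ), (∀ i, IsAlgebraic (IntermediateField.adjoin ℚ (Set.range u)) (Complex.exp (u i))) ∧ w ∈ Submodule.span ℚ (Set.range u)}).mkQ ∘ x) → Algebra.trdeg ℚ (IntermediateField.adjoin ℚ (Set.range v ∪ Set.range (Complex.exp ∘ v))) + (m : Cardinal) ≤ Algebra.trdeg ℚ (IntermediateField.adjoin ℚ (Set.range v ∪ Set.range (Complex.exp ∘ v) ∪ (Set.range x ∪ Set.range (Complex.exp ∘ x))))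

/-- item stmt-Schanuel-12196 · crux · rank 5 · open · by planner
why it might fail: False only with SC: iff some real algebraic x ≠ 0 has an eventually periodic continued-logarithm/ -exponential expansion — a sparse depth-(m+p) tower identity in a shape no PSLQ search probes; certified ball-arithmetic search (kit j000302) pending.
sources: Renyi1957, Neunhauserer2018, SchmidtPisot1980, Waldschmidt2000
[crux] ANTI-LAGRANGE FOR THE EXPONENTIAL GAUSS MAPS (the card's statement, all patterns; verbatim
the mooted stmt-Schanuel-7598): (T) for every real algebraic x ≠ 0 and all m, p > 0, T^(m+p) x ≠ T^m
x where T y = {eʸ} = Int.fract (exp y); (S) for every real algebraic x > 0, x ≠ 1 and all m, p > 0,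
S^(m+p) x ≠ S^m x where S y = {−log y} (Lean's log 0 = 0 makes terminating continued exponentials
eventually 0, deliberately included). Pattern m + p = 1 is HL; m + p = 2 is SecondOrderHL /
ExpLogLinearRung; x = 1 of (T) is ENotLogParry. Implied by RecursiveHermiteLindemann (support
AntiLagrangeOfRecursiveHL, already proved as evidence on stmt-Schanuel-7610). [deps:
RecursiveHermiteLindemann] [difficulty: open-problem] -/
@[route_item "route-Schanuel-RecursiveCore"]
def AntiLagrange : Prop :=
  (∀ x : ℝ, IsAlgebraic ℚ x → x ≠ 0 → ∀ m p : ℕ, 0 < p → (fun y : ℝ => Int.fract (Real.exp y))^[m + p] x ≠ (fun y : ℝ => Int.fract (Real.exp y))^[m] x) ∧ (∀ x : ℝ, IsAlgebraic ℚ x → 0 < x → x ≠ 1 → ∀ m p : ℕ, 0 < p → (fun y : ℝ => Int.fract (-Real.log y))^[m + p] x ≠ (fun y : ℝ => Int.fract (-Real.log y))^[m] x)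

/-- item stmt-Schanuel-12197 · support · rank 9 · open · by planner
sources: Waldschmidt2000, Kirby2010EAEF, Lang1966
[support] EXACTNESS OF THE SPLIT: Schanuel → RecursiveSchanuel ∧ OffRecursiveSchanuel (first: trdeg
ℚ(z, e^z) = trdeg ℚ(z) ≥ n forces algebraic independence, tree lemmas
`algebraicIndependent_of_le_trdeg_adjoin`, `trdeg_adjoin_union_eq_of_isAlgebraic` generalised to T
algebraic over K(S); second: take a basis B ⊆ coordinates of span v, B ++ x is ℚ-free because x is
free mod 𝓡 ⊇ span v, Schanuel gives |B| + m ≤ trdeg, and trdeg ℚ(v, e^v) = trdeg ℚ(B) ≤ |B|).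
Certifies that no item of the route is refutable short of refuting Schanuel. [difficulty:
provable-now] -/
@[route_item "route-Schanuel-RecursiveCore"]
def SplitOfSchanuel : Prop :=
  _root_.Schanuel → RecursiveSchanuel ∧ OffRecursiveSchanuel

/-- item stmt-Schanuel-12198 · support · rank 9 · open · by planner
sources: Waldschmidt2000, BakerTNT1975
[support] RecursiveSchanuel → RecursiveHermiteLindemann (choose a ℚ-basis B among the z_i; B is
recursive since a_i + Σ c_ij z_j ∈ ℚ̄ + ℚ(B) is algebraic over ℚ(B); B algebraically independent ⟹ a
nonzero ℚ-combination Σ d_i b_i cannot be a root of a nonzero rational polynomial). [difficulty: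
provable-now] -/
@[route_item "route-Schanuel-RecursiveCore"]
def HLShadowOfRecursive : Prop :=
  RecursiveSchanuel → RecursiveHermiteLindemann

/-- item stmt-Schanuel-12199 · support · rank 9 · open · by planner
sources: Renyi1957, BakerTNT1975, Kirby2010EAEF
[support] RecursiveHermiteLindemann → AntiLagrange (the old ExpGaussMap assembly, PROVED sorry-free
as refuter evidence AssemblySch.lean on stmt-Schanuel-7610: T-orbits are linearly recursive tuples
e^{z_i} = z_{i+1} + ⌊e^{z_i}⌋ containing the algebraic x; S-orbits in log-coordinates w_i = −(k_i +
y_{i+1}) with the case split at the first zero / purely periodic / minimal preperiod supplying a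
nonzero algebraic element of the span). [difficulty: provable-now] -/
@[route_item "route-Schanuel-RecursiveCore"]
def AntiLagrangeOfRecursiveHL : Prop :=
  RecursiveHermiteLindemann → AntiLagrange

/-- item stmt-Schanuel-12200 · support · rank 9 · open · by planner
sources: BakerTNT1975, Chudnovsky1984, Rivoal2024, Waldschmidt2004
[support] HERMITE–LINDEMANN ONE STOREY UP (named rung = pattern length 2 of AntiLagrange; verbatim
stmt-Schanuel-7601): for algebraic β ≠ 0 and rational a, b with b ≠ 0, e^(a + b·e^β) is
transcendental (contains e^e, e^{1/e}, e^{e^√2} ∉ ℚ̄; in print only 'e^e or e^{e²}',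
Brownawell–Waldschmidt, BakerTNT1975 Thm 12.2 p. 111). [difficulty: open-problem] -/
@[route_item "route-Schanuel-RecursiveCore"]
def SecondOrderHL : Prop :=
  ∀ β : ℂ, IsAlgebraic ℚ β → β ≠ 0 → ∀ a b : ℚ, b ≠ 0 → Transcendental ℚ (Complex.exp ((a : ℂ) + (b : ℂ) * Complex.exp β))

/-- item stmt-Schanuel-12201 · support · rank 9 · open · by planner
sources: BakerTNT1975, Hermite1873
[support] RecursiveHermiteLindemann → SecondOrderHL (n = 2 with z = (β, a + b e^β); PROVED
sorry-free as refuter evidence on stmt-Schanuel-7605, to be re-landed in Theorems). [difficulty: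
provable-now] -/
@[route_item "route-Schanuel-RecursiveCore"]
def RecursiveGivesSecondOrder : Prop :=
  RecursiveHermiteLindemann → SecondOrderHL

/-- item stmt-Schanuel-12202 · support · rank 9 · open · by planner
sources: BakerTNT1975, Rivoal2024, Chudnovsky1984, Waldschmidt2004, FischlerRivoal2024
[support] the depth-one MIXED LINEAR RUNG over ℚ̄ (verbatim stmt-Schanuel-7600; shared with cards
linear-schanuel-all-depths L1 and tensor-mixed-gevrey-division): for algebraic α ≠ 0 and l ≠ 0 with
e^l algebraic, c₀ + c₁e^α + c₂l = 0 with algebraic c's forces c₁ = c₂ = 0 (contains 1, e, π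
ℚ̄-independent via l = iπ; the S-pattern (1,1) into W(e^{−k})). Implied by RecursiveSchanuel at n =
2. [difficulty: open-problem] -/
@[route_item "route-Schanuel-RecursiveCore"]
def ExpLogLinearRung : Prop :=
  ∀ α l : ℂ, IsAlgebraic ℚ α → α ≠ 0 → IsAlgebraic ℚ (Complex.exp l) → l ≠ 0 → ∀ c₀ c₁ c₂ : ℂ, IsAlgebraic ℚ c₀ → IsAlgebraic ℚ c₁ → IsAlgebraic ℚ c₂ → c₀ + c₁ * Complex.exp α + c₂ * l = 0 → c₁ = 0 ∧ c₂ = 0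

/-- item stmt-Schanuel-12203 · support · rank 9 · open · by planner
sources: BakerTNT1975, SchmidtPisot1980, Neunhauserer2018, AdamczewskiBugeaud2007
[support] e IS NOT A LOG-PARRY BASE (flagship single-orbit instance, x = 1 of AntiLagrange(T);
verbatim stmt-Schanuel-7602, whose certified-numerics notes carry over: no pattern with m + p ≤ 1500
at 820 digits): the T-orbit of 1 (T 1 = e − 2, T² 1 = e^{e−2} − 2 = 0.0509…) is not eventually
periodic. [difficulty: open-problem] -/
@[route_item "route-Schanuel-RecursiveCore"]
def ENotLogParry : Prop :=
  ∀ m p : ℕ, 0 < p → (fun y : ℝ => Int.fract (Real.exp y))^[m + p] 1 ≠ (fun y : ℝ => Int.fract (Real.exp y))^[m] 1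

/-- item stmt-Schanuel-12205 · support · rank 9 · open · by planner
sources: Hermite1873, Lindemann1882, MantovaZannier2016
[support] THE RECURSIVE CORE IS STRICTLY BIGGER THAN 𝓛 = exp⁻¹(ℚ̄), unconditionally: some w in the
span of a recursive tuple has e^w transcendental (witness: the real root w ∈ (1/2, 1) of e^w = 3w by
the intermediate value theorem; (w) is recursive; w algebraic would make e^w = 3w both
transcendental (HL, tree `transcendental_exp_holds`) and algebraic). [difficulty: provable-now] -/
@[route_item "route-Schanuel-RecursiveCore"]
def CoreBeyondLogs : Prop :=
  ∃ w : ℂ, (∃ (k : ℕ) (v : Fin k → ℂ), (∀ i, IsAlgebraic (IntermediateField.adjoin ℚ (Set.range v)) (Complex.exp (v i))) ∧ w ∈ Submodule.span ℚ (Set.range v)) ∧ Transcendental ℚ (Complex.exp w)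

-- earlier LogSectorInside (stmt-Schanuel-12204, replaced 2026-08-15T18:53:59Z -> stmt-Schanuel-12338): retired by None — RecursiveSchanuel → Literature.Barriers.Schanuel.AlgIndepLogarithms
/-- item stmt-Schanuel-12338 · support · rank 9 · open · by planner
sources: Roy1992, Pila2022, Waldschmidt2005
[support] THE LOG SECTOR SITS INSIDE THE RECURSIVE SECTOR: RecursiveSchanuel → algebraic
independence of ℚ-linearly independent logarithms of algebraic numbers (the statement of
`Literature.Barriers.Schanuel.AlgIndepLogarithms`, inlined verbatim exactly as LogPatterns.LogSector
so that the route reaches no undeclared @[conjecture] leaf; a tuple of logarithms of algebraic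
numbers is recursive: e^{l_i} ∈ ℚ̄ is algebraic over ℚ(l)). Makes the containment
LogPatterns.LogSector ⊆ RecursiveSchanuel and the barrier AlgebraicIndependenceOfLogarithms explicit
theorems. [difficulty: provable-now] [Roy1992, Pila2022, Waldschmidt2005] -/
@[route_item "route-Schanuel-RecursiveCore"]
def LogSectorInside : Prop :=
  RecursiveSchanuel → ∀ (n : ℕ) (l : Fin n → ℂ), (∀ i, IsAlgebraic ℚ (Complex.exp (l i))) → LinearIndependent ℚ l → AlgebraicIndependent ℚ l

/-- item stmt-Schanuel-12206 · assembly · rank 1 · open · by planner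
sources: Kirby2010EAEF, Waldschmidt2000, Lang1966
[assembly] RecursiveSchanuel → OffRecursiveSchanuel → Schanuel (adapted basis of span z ∩ 𝓡, tower
law, finiteness of all transcendence degrees involved). -/
@[route_item "route-Schanuel-RecursiveCore", crux]
def Assembly : Prop :=
  RecursiveSchanuel → OffRecursiveSchanuel → _root_.Schanuel

/-! D-0027 §2.1 — DECIDING THEOREM (planner-authored via `route open/edit --closes-file`; by planner-plancard-Schanuel-Schanuel-exp-gauss--8e5a92ae-g2-0 2026-08-15T18:51:04Z):
its hypotheses are this route's items and its conclusion the sub-problem Statement (glue_lint), and it elaborates with this file. -/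

@[closes "route-Schanuel-RecursiveCore"] theorem closes (hR : RecursiveSchanuel) (hO : OffRecursiveSchanuel) (hA : Assembly) : _root_.Schanuel :=
  hA hR hO

end Summit.Schanuel.Schanuel.Theses.RecursiveCore
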